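import Literature.IUT.LogVolume.GenuineLogThetaExactVolume
import HarnessLib

/-!
# The slot-choice lower bound for the genuine `−|log(Θ)|` and a place-combinatorial SUFFICIENT condition for
# [IUTchIII] Cor. 3.12 at a genuine input (Dupuy–Hilado §4.7, §4.11–4.12; [IUTchIV] Thm. 1.10 Step (v), (Ind1))

Record/proof-only file of the abc-iut cell (Cor. 3.12 crew, L-DH lane, seat abc-iut-c312-3; sequel to
`GenuineLogThetaExactVolume.lean`, item «XXVIIc-DH»). TAKES NO SIDE on [IUTchIII] Cor. 3.12.

With (Ind1) ranging over ALL permutations of the `j+1` capsule indices ([IUTchIV] Thm. 1.10 Step (v), two loci: p. 27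
"the indeterminacies (Ind1) and (Ind2) are taken into account by the arbitrary nature of the automorphism “φ”
[cf. Proposition 1.2]" and p. 28 "“λ” is asymmetric with respect to the choice of “`i† ∈ I`” in `S^±_{j+1}` … after
symmetrizing with respect to the choice of “`i† ∈ I`” in `S^±_{j+1}`"; the cell's ruling R2 on how these two sentences
are typed is HOME/plan/c312/STEPV-IND1-NOTE.md; skeleton XXII/XXVIc at the summand level), the
possible images of the sharp Θ-region at the summand `v⃗ = (v_0,…,v_j)` contain the bare region `ι_a(t_{Θ,i,v_a})·(R_I)^∼`
twisted through EVERY slot `a` — not only the last one. Hence the hull's log-volume is at least `log‖t_{Θ,i,v_a}‖`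
for every `a`, and for every SLOT SELECTOR `s(i,v⃗) ∈ {0,…,j}`:

* packet level (`realPrimePacketWith p 𝔽 c`, any shell): `realPrimePacketWith_iota_smul_subset_possibleImages`,
  `realPrimePacketWith_log_norm_le_logμ_possibleImagesHull`, **`realPrimePacketWith_negLogThetaAt_ge_slotChoice`**:
  `(1/ℓ⋇)·Σ_i Σ_{v⃗} log‖t_{i,v_{s(i,v⃗)}}‖·Π_b Pr(v_b) ≤ −|log(Θ)|_p`;
* input level (`I : ThetaVolumeInput F₀ K`, the idele norms read off the Θ-pilot divisor by `tΘ_ord`):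
  **`ThetaVolumeInput.negLogThetaNonarch_ge_slotChoice`**:
  `−Σ_{p∈T(I)} (1/ℓ⋇)·Σ_i Σ_{v⃗∈𝕍_p^{i+2}} P_{Θ,i}(v_{s})·ln N(v_{s})/n_{v_{s}}·Π_b Pr(v_b) ≤ negLogThetaNonarch I`
  (at `s ≡` last slot this is the free inequality `−deĝ̲_lgp(P_Θ) ≤ negLogThetaNonarch I` of `LDHGenuine`);
* **`cor312NonarchOf_of_slotChoice`** / **`cor312Of_of_slotChoice`** — a SUFFICIENT condition for Dupuy–Hilado's
  (1.1) / [IUTchIII] Cor. 3.12 at the genuine input, in PILOT DATA AND PLACES ONLY: if for some slot selector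
  `deĝ̲(P_q) ≥ Σ_{p∈T(I)} (1/ℓ⋇)·Σ_i Σ_{v⃗} P_{Θ,i}(v_{s(i,v⃗)})·ln N(v_s)/n_{v_s}·Π Pr` — i.e. the weighted mass of
  the tuples ALL of whose slots are deep bad places is at most `|log(q)|` — then `Cor312Of I` HOLDS. This is the
  DH-GLOBAL, genuine-input form of the summand-level «readings HOLD at mixed summands» (skeleton XXVIc
  `readings_hold_of_unit_slot`, abc-iut-w4-d096 `ForkPacketCompetition`): place combinatorics of `(F₀, 𝕍^bad)`
  alone (e.g. every bad place of small relative local degree `Pr(v)`) can put a genuine input on the TRUE side of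
  the sharp-model fork, exactly as depth at a non-split bad prime puts it on the FALSE side (abc-iut-w5-d157
  `LDHPerPrimeReading`, `LDHSyntheticCor312Failure/Holds` for synthetic inputs). No free lunch: for such inputs the
  squeeze `LDHGenuine.gap_le_of_cor312Of` is vacuous, the (Ind1)-slot term of `explicitDelta` absorbing the mixed mass.

[cite: DupuyHilado2025, §3.9, §4.7, §4.11, §4.12] [cite: Mochizuki2012, IUTchIV Thm. 1.10 Step (v) p. 27–28]
[cite: Mochizuki2012, IUTchIII Cor. 3.12 p. 173–174] [claim: Mochizuki2012, status: disputed] HONEST SCOPE: the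
sufficient condition is a HYPOTHESIS on the input, discharged for no particular curve here; (Ind1)/(Ind2)/the hull
are the tree's typings of disputed-corpus constructions; nothing about print's Cor. 3.12 is asserted.
PROOF-ONLY file: no definitions, no named `Prop` facts; typed ≠ proved.
-/

noncomputable section

open Set Module NumberField IsDedekindDomain
open scoped Pointwise TensorProduct

namespace Literature.IUT.LogVolume

/-! ## Packet level -/

section RealPacketWith

variable {F : Type} [Field F] [NumberField F]
variable (p : ℕ) [Fact p.Prime] (𝔽 : LocalFields F p)
variable (c : (j : ℕ) → (Fin (j + 1) → placesOver F p) → ℚ_[p]) (hc0 : ∀ j e, c j e ≠ 0)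
  (hcσ : ∀ (j : ℕ) (σ : Equiv.Perm (Fin (j + 1))) (e : Fin (j + 1) → placesOver F p), c j (e ∘ σ) = c j e)

/-- **Every slot's bare region is a possible image** ((Ind1) = all permutations): at the summand `v⃗ = e` of degree
`j = i+1 ≤ ℓ⋇`, `ι_a(t_{i,v_a})·(R_I)^∼ ⊆ possibleImages(O_𝕃(−div t))_{v⃗}` for EVERY slot `a` (the transposition
`(a j)` and the identity of (Ind2)). [cite: DupuyHilado2025, §4.7, §4.11] -/
theorem realPrimePacketWith_iota_smul_subset_possibleImages {lstar : ℕ}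
    (t : Fin lstar → (v : placesOver F p) → (𝔽.k v)ˣ) (i : Fin lstar)
    (e : Fin ((i : ℕ) + 1 + 1) → placesOver F p) (a : Fin ((i : ℕ) + 1 + 1)) :
    iota p (fun b => 𝔽.k (e b)) a (t i (e a) : 𝔽.k (e a)) •
        (normalizedPacket p (fun b => 𝔽.k (e b)) : Set (PacketAlgebra p (fun b => 𝔽.k (e b)))) ⊆
      (realPrimePacketWith p 𝔽 c hc0 hcσ).possibleImages
        ((realPrimePacketWith p 𝔽 c hc0 hcσ).pilotRegion t) ((i : ℕ) + 1) e := by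
  rw [realPrimePacketWith_possibleImages_pilotRegion_eq]
  intro x hx
  refine Set.mem_iUnion.mpr ⟨1, ?_⟩
  rw [one_smul]
  exact Set.mem_iUnion.mpr ⟨a, hx⟩

/-- **The Θ-hull at a summand has log-volume at least `log‖t_{i,v_a}‖` for EVERY slot `a`** (monotonicity of
`log μ̄` along `ι_a(t_{i,v_a})·(R_I)^∼ ⊆ possible images ⊆ hull`, `log μ̄(ι_a(t)·(R_I)^∼) = log‖t‖`).
[cite: DupuyHilado2025, §3.7, §4.12] -/
theorem realPrimePacketWith_log_norm_le_logμ_possibleImagesHull {lstar : ℕ}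
    (t : Fin lstar → (v : placesOver F p) → (𝔽.k v)ˣ) (i : Fin lstar)
    (e : Fin ((i : ℕ) + 1 + 1) → placesOver F p) (a : Fin ((i : ℕ) + 1 + 1)) :
    Real.log ‖(t i (e a) : 𝔽.k (e a))‖ ≤
      (realPrimePacketWith p 𝔽 c hc0 hcσ).logμ ((realPrimePacketWith p 𝔽 c hc0 hcσ).possibleImagesHull
        ((realPrimePacketWith p 𝔽 c hc0 hcσ).pilotRegion t) ((i : ℕ) + 1) e) := by
  obtain ⟨m, -, -, -, hadm, -⟩ :=
    realPrimePacketWith_exists_content_logμ_possibleImagesHull p 𝔽 c hc0 hcσ t i e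
  have hsub : iota p (fun b => 𝔽.k (e b)) a (t i (e a) : 𝔽.k (e a)) •
        (normalizedPacket p (fun b => 𝔽.k (e b)) : Set (PacketAlgebra p (fun b => 𝔽.k (e b)))) ⊆
      (realPrimePacketWith p 𝔽 c hc0 hcσ).possibleImagesHull
        ((realPrimePacketWith p 𝔽 c hc0 hcσ).pilotRegion t) ((i : ℕ) + 1) e :=
    (realPrimePacketWith_iota_smul_subset_possibleImages p 𝔽 c hc0 hcσ t i e a).trans
      ((realPrimePacketWith p 𝔽 c hc0 hcσ).possibleImages_subset_hull _ _ _)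
  have hadm1 : PacketAdm p (fun b => 𝔽.k (e b)) (iota p (fun b => 𝔽.k (e b)) a (t i (e a) : 𝔽.k (e a)) •
      (normalizedPacket p (fun b => 𝔽.k (e b)) : Set (PacketAlgebra p (fun b => 𝔽.k (e b))))) :=
    packetAdm_iota_smul p (fun b => 𝔽.k (e b)) a (t i (e a)).ne_zero (packetAdm_normalizedPacket p _)
  have h := packetLogμ_mono p (fun b => 𝔽.k (e b)) hadm1 hadm hsub
  rwa [packetLogμ_iota_smul_normalizedPacket p (fun b => 𝔽.k (e b)) a (t i (e a)).ne_zero] at h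

/-- **The slot-choice lower bound for `−|log(Θ)|_p`**: for every slot selector `s(i,v⃗)`,
`(1/ℓ⋇)·Σ_i Σ_{v⃗} log‖t_{i,v_{s(i,v⃗)}}‖·Π_b Pr(v_b) ≤ −|log(Θ)|_p`. [cite: DupuyHilado2025, Def. 3.6.3, §4.12] -/
theorem realPrimePacketWith_negLogThetaAt_ge_slotChoice {lstar : ℕ}
    (t : Fin lstar → (v : placesOver F p) → (𝔽.k v)ˣ)
    (s : (i : Fin lstar) → (Fin ((i : ℕ) + 1 + 1) → placesOver F p) → Fin ((i : ℕ) + 1 + 1)) :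
    (1 / (lstar : ℝ)) * ∑ i : Fin lstar, ∑ e : Fin ((i : ℕ) + 1 + 1) → placesOver F p,
        Real.log ‖(t i (e (s i e)) : 𝔽.k (e (s i e)))‖ * ∏ b, weight F (e b).1 ≤
      (realPrimePacketWith p 𝔽 c hc0 hcσ).negLogThetaAt lstar t := by
  unfold PrimePacket.negLogThetaAt PrimePacket.lnνLp PrimePacket.lnνTensorPower
  refine mul_le_mul_of_nonneg_left ?_ (by positivity)
  refine Finset.sum_le_sum fun i _ => Finset.sum_le_sum fun e _ => ?_
  exact mul_le_mul_of_nonneg_right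
    (realPrimePacketWith_log_norm_le_logμ_possibleImagesHull p 𝔽 c hc0 hcσ t i e (s i e))
    (Finset.prod_nonneg fun b _ => weight_nonneg F (e b).1)

end RealPacketWith

/-! ## Input level -/

namespace ThetaVolumeInput

variable {F₀ : Type} [Field F₀] [NumberField F₀] {K : Type} [Field K] [NumberField K] [Algebra F₀ K]
variable (I : ThetaVolumeInput F₀ K)

/-- The idele norms of a genuine input, read off the Θ-pilot divisor: `log‖t_{Θ,i,v}‖ = −P_{Θ,i}(v)·ln N(v)/n_v`
((3.4) with `ord_v(t_{Θ,i,v}) = P_{Θ,i}(v)`). [cite: DupuyHilado2025, §3.4, §3.9] -/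
theorem log_norm_tΘ (p : ℕ) [hp : Fact p.Prime] (i : Fin I.lstar) (v : placesOver F₀ p) :
    Real.log ‖(I.tΘ p hp.out i v : (I.σ.localFieldFamily p hp.out).k v)‖ =
      -(I.X.thetaPilot i v.1) * logNorm F₀ v.1 / localDegree F₀ v.1 := by
  rw [LocalFields.log_norm_eq_neg_ordv, I.tΘ_ord p hp.out i v]

/-- **The slot-choice lower bound at a prime**, in pilot data: for every slot selector `s`,
`−(1/ℓ⋇)·Σ_i Σ_{v⃗∈𝕍_p^{i+2}} P_{Θ,i}(v_s)·ln N(v_s)/n_{v_s}·Π_b Pr(v_b) ≤ negLogThetaLoc I p`.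
[cite: DupuyHilado2025, Def. 3.6.3, §4.12] [cite: Mochizuki2012, IUTchIV Thm. 1.10 Step (v) p. 27–28] -/
theorem negLogThetaLoc_ge_slotChoice (p : ℕ) [hp : Fact p.Prime]
    (s : (i : Fin I.lstar) → (Fin ((i : ℕ) + 1 + 1) → placesOver F₀ p) → Fin ((i : ℕ) + 1 + 1)) :
    (1 / (I.lstar : ℝ)) * ∑ i : Fin I.lstar, ∑ e : Fin ((i : ℕ) + 1 + 1) → placesOver F₀ p,
        (-(I.X.thetaPilot i (e (s i e)).1) * logNorm F₀ (e (s i e)).1 / localDegree F₀ (e (s i e)).1) *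
          ∏ b, weight F₀ (e b).1 ≤
      I.negLogThetaLoc p := by
  have h := realPrimePacketWith_negLogThetaAt_ge_slotChoice p (I.σ.localFieldFamily p hp.out)
    (mScale p (I.σ.localFieldFamily p hp.out)) (mScale_ne_zero p (I.σ.localFieldFamily p hp.out))
    (mScale_perm p (I.σ.localFieldFamily p hp.out)) (I.tΘ p hp.out) s
  have hL : (1 / (I.lstar : ℝ)) * ∑ i : Fin I.lstar, ∑ e : Fin ((i : ℕ) + 1 + 1) → placesOver F₀ p,
        Real.log ‖(I.tΘ p hp.out i (e (s i e)) : (I.σ.localFieldFamily p hp.out).k (e (s i e)))‖ *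
          ∏ b, weight F₀ (e b).1 =
      (1 / (I.lstar : ℝ)) * ∑ i : Fin I.lstar, ∑ e : Fin ((i : ℕ) + 1 + 1) → placesOver F₀ p,
        (-(I.X.thetaPilot i (e (s i e)).1) * logNorm F₀ (e (s i e)).1 / localDegree F₀ (e (s i e)).1) *
          ∏ b, weight F₀ (e b).1 := by
    refine congrArg (fun x : ℝ => (1 / (I.lstar : ℝ)) * x) (Finset.sum_congr rfl fun i _ => ?_)
    refine Finset.sum_congr rfl fun e _ => ?_
    rw [I.log_norm_tΘ p i (e (s i e))]
  rw [← hL, I.negLogThetaLoc_of_prime hp.out]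
  exact h

/-- **The slot-choice lower bound for the genuine `−|log(Θ)|`**: for every slot selector `s`,
`−Σ_{p∈T(I)} (1/ℓ⋇)·Σ_i Σ_{v⃗∈𝕍_p^{i+2}} P_{Θ,i}(v_{s(p,i,v⃗)})·ln N(v_s)/n_{v_s}·Π_b Pr(v_b) ≤ negLogThetaNonarch I`
(at the last-slot selector: the free inequality `−deĝ̲_lgp(P_Θ) ≤ negLogThetaNonarch I`).
[cite: DupuyHilado2025, §1 (1.1), §4.12] [cite: Mochizuki2012, IUTchIV Thm. 1.10 Step (v) p. 27–28] -/
theorem negLogThetaNonarch_ge_slotChoice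
    (s : (p : ℕ) → (i : Fin I.lstar) → (Fin ((i : ℕ) + 1 + 1) → placesOver F₀ p) → Fin ((i : ℕ) + 1 + 1)) :
    ∑ p ∈ I.supportPrimes, (1 / (I.lstar : ℝ)) * ∑ i : Fin I.lstar, ∑ e : Fin ((i : ℕ) + 1 + 1) → placesOver F₀ p,
        (-(I.X.thetaPilot i (e (s p i e)).1) * logNorm F₀ (e (s p i e)).1 / localDegree F₀ (e (s p i e)).1) *
          ∏ b, weight F₀ (e b).1 ≤
      I.negLogThetaNonarch := by
  unfold negLogThetaNonarch
  refine Finset.sum_le_sum fun p hpT => ?_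
  haveI : Fact p.Prime := ⟨I.prime_of_mem_supportPrimes hpT⟩
  exact I.negLogThetaLoc_ge_slotChoice p (s p)

/-- **A place-combinatorial SUFFICIENT condition for Dupuy–Hilado's (1.1) at a genuine input**: if for some slot
selector `s` the `q`-pilot degree dominates the slot-selected Θ-mass,
`−deĝ̲(P_q) ≤ −Σ_{p∈T(I)} (1/ℓ⋇)·Σ_i Σ_{v⃗} P_{Θ,i}(v_{s})·ln N(v_s)/n_{v_s}·Π Pr`
(the weighted mass of the tuples ALL of whose slots are deep bad places is at most `|log(q)|`), then
`Cor312NonarchOf I`. The hypothesis concerns pilot data and places only; it is NOT discharged for any input here.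
[claim: Mochizuki2012, status: disputed] [cite: DupuyHilado2025, §1 (1.1), §4.7, §4.12] -/
theorem cor312NonarchOf_of_slotChoice
    (s : (p : ℕ) → (i : Fin I.lstar) → (Fin ((i : ℕ) + 1 + 1) → placesOver F₀ p) → Fin ((i : ℕ) + 1 + 1))
    (h : -FinDivisor.ndeg F₀ I.X.qPilot ≤
      ∑ p ∈ I.supportPrimes, (1 / (I.lstar : ℝ)) * ∑ i : Fin I.lstar, ∑ e : Fin ((i : ℕ) + 1 + 1) → placesOver F₀ p,
        (-(I.X.thetaPilot i (e (s p i e)).1) * logNorm F₀ (e (s p i e)).1 / localDegree F₀ (e (s p i e)).1) *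
          ∏ b, weight F₀ (e b).1) :
    I.Cor312NonarchOf := by
  unfold Cor312NonarchOf negAbsLogQ
  exact h.trans (I.negLogThetaNonarch_ge_slotChoice s)

/-- **… hence for [IUTchIII] Cor. 3.12 at the input** (`Cor312Of I`, adding the positive archimedean summand): the
DH-GLOBAL genuine-input form of «the readings HOLD at mixed summands» (skeleton XXVIc, `ForkPacketCompetition`) — place
combinatorics of `(F₀, 𝕍^bad)` alone can put a genuine input on the TRUE side of the sharp-model fork. The
hypothesis is NOT discharged for any input here. [claim: Mochizuki2012, status: disputed]
[cite: Mochizuki2012, IUTchIII Cor. 3.12 p. 173–174] -/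
theorem cor312Of_of_slotChoice
    (s : (p : ℕ) → (i : Fin I.lstar) → (Fin ((i : ℕ) + 1 + 1) → placesOver F₀ p) → Fin ((i : ℕ) + 1 + 1))
    (h : -FinDivisor.ndeg F₀ I.X.qPilot ≤
      ∑ p ∈ I.supportPrimes, (1 / (I.lstar : ℝ)) * ∑ i : Fin I.lstar, ∑ e : Fin ((i : ℕ) + 1 + 1) → placesOver F₀ p,
        (-(I.X.thetaPilot i (e (s p i e)).1) * logNorm F₀ (e (s p i e)).1 / localDegree F₀ (e (s p i e)).1) *
          ∏ b, weight F₀ (e b).1) :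
    I.Cor312Of :=
  I.cor312Of_of_cor312NonarchOf (I.cor312NonarchOf_of_slotChoice s h)

end ThetaVolumeInput

end Literature.IUT.LogVolume

end
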